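import Mathlib

/-!
# Counting divisor configurations of a pair of linear forms through the cofactor

For a pair of linear forms `q₀n + a₀`, `q₁n + a₁` the configurations `(d₀, d₁, m)` with
`q₁ ∣ d₁m − a₁`, `n := (d₁m − a₁)/q₁ ∈ [1,x]`, `d₀ ∣ q₀n + a₀ ≥ 1` (the "cofactor parametrisation"
`q₁n + a₁ = d₁·m` of the divisor pairs `d₀ ∣ q₀n+a₀`, `d₁ ∣ q₁n+a₁`) inject into the configurations
`(n, d₀, d₁)`; this file records the resulting comparisons of filtered cardinalities and the count of
`(n, d₀, d₁)` over an `n`-set by `τ((q₀n+a₀)⁺)·τ((q₁n+a₁)⁺)` (used in the middle range of the linear pair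
window of the Möbius tail, crux `PolyMobiusTail`). Everything here is PROVED.
-/

open Finset Real

namespace Literature.NumberTheory.Sieve

namespace LinearPairConfig


/-- **Injection bound.** For predicates `Φ` on `(d₀,d₁,m)` and `Ψ` on `(n,d₀,d₁)` with
`Core ∧ Φ ⟹ Ψ(n, d₀, d₁)` (`n = (d₁m − a₁)/q₁`), the number of `(d₀,d₁,m) ∈ A × [1,Xb] × Mset`
(`A ⊆ [1,Xb]`, `Mset ⊆ [1, ∞)`) satisfying the core conditions C1, C3, C2⁺, C2 and `Φ` is at most
the number of `(n,d₀,d₁) ∈ [1,x] × [1,Xb]²` with `d₀ ∣ q₀n + a₀ ≥ 1`, `d₁ ∣ q₁n + a₁ ≥ 1` and `Ψ`. [folklore] -/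
theorem card_core_filter_le {q₀ a₀ q₁ a₁ : ℤ} {x Xb : ℕ} {A Mset : Finset ℕ}
    (hA : A ⊆ Icc 1 Xb) (hM : ∀ m ∈ Mset, 1 ≤ m)
    (Φ : ℕ × ℕ → ℕ → Prop) [DecidablePred (fun c : (ℕ × ℕ) × ℕ => Φ c.1 c.2)]
    (Ψ : ℕ → ℕ × ℕ → Prop) [DecidablePred (fun e : ℕ × (ℕ × ℕ) => Ψ e.1 e.2)]
    (hΦΨ : ∀ (d₀ d₁ m : ℕ), d₁ ∈ Icc 1 Xb → m ∈ Mset →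
      ((d₁ : ℤ) * m - a₁) % q₁ = 0 →
      (1 ≤ ((d₁ : ℤ) * m - a₁) / q₁ ∧ ((d₁ : ℤ) * m - a₁) / q₁ ≤ x) →
      Φ (d₀, d₁) m → Ψ ((((d₁ : ℤ) * m - a₁) / q₁).toNat) (d₀, d₁)) :
    (((A ×ˢ Icc 1 Xb) ×ˢ Mset).filter (fun c : (ℕ × ℕ) × ℕ =>
        ((((c.1.2 : ℤ) * c.2 - a₁) % q₁ = 0 ∧
          (1 ≤ ((c.1.2 : ℤ) * c.2 - a₁) / q₁ ∧ ((c.1.2 : ℤ) * c.2 - a₁) / q₁ ≤ x) ∧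
          (1 ≤ q₀ * (((c.1.2 : ℤ) * c.2 - a₁) / q₁) + a₀ ∧
            (c.1.1 : ℤ) ∣ q₀ * (((c.1.2 : ℤ) * c.2 - a₁) / q₁) + a₀)) ∧ Φ c.1 c.2))).card ≤
    (((Icc 1 x) ×ˢ ((Icc 1 Xb) ×ˢ (Icc 1 Xb))).filter (fun e : ℕ × (ℕ × ℕ) =>
        ((1 ≤ q₀ * e.1 + a₀ ∧ (e.2.1 : ℤ) ∣ q₀ * e.1 + a₀) ∧
          (1 ≤ q₁ * e.1 + a₁ ∧ (e.2.2 : ℤ) ∣ q₁ * e.1 + a₁)) ∧ Ψ e.1 e.2)).card := by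
  -- the map
  refine Finset.card_le_card_of_injOn
    (fun c : (ℕ × ℕ) × ℕ => (((((c.1.2 : ℤ) * c.2 - a₁) / q₁).toNat), c.1)) ?_ ?_
  · -- maps into
    intro c hc
    rw [Finset.mem_coe, Finset.mem_filter] at hc
    obtain ⟨hmem, ⟨hC1, ⟨hn1, hnx⟩, hC2p, hC2⟩, hΦ⟩ := hc
    rw [Finset.mem_product, Finset.mem_product] at hmem
    obtain ⟨⟨hd₀, hd₁⟩, hm⟩ := hmem
    set nn : ℤ := ((c.1.2 : ℤ) * c.2 - a₁) / q₁ with hnn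
    have hq : q₁ * nn = (c.1.2 : ℤ) * c.2 - a₁ := Int.mul_ediv_cancel' (Int.dvd_of_emod_eq_zero hC1)
    have hnn0 : 0 ≤ nn := by omega
    have hcast : ((nn.toNat : ℕ) : ℤ) = nn := Int.toNat_of_nonneg hnn0
    rw [Finset.mem_coe, Finset.mem_filter, Finset.mem_product, Finset.mem_product]
    refine ⟨⟨?_, hA hd₀, hd₁⟩, ⟨⟨?_, ?_⟩, ?_, ?_⟩, ?_⟩
    · rw [Finset.mem_Icc]
      constructor
      · have : (1 : ℤ) ≤ nn.toNat := by rw [hcast]; exact hn1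
        exact_mod_cast this
      · have : (nn.toNat : ℤ) ≤ x := by rw [hcast]; exact hnx
        exact_mod_cast this
    · simp only []
      rw [hcast]; exact hC2p
    · simp only []
      rw [hcast]; exact hC2
    · simp only []
      rw [hcast, show q₁ * nn + a₁ = (c.1.2 : ℤ) * c.2 by rw [hq]; ring]
      have h1 : (1 : ℤ) ≤ c.1.2 := by exact_mod_cast (Finset.mem_Icc.mp hd₁).1
      have h2 : (1 : ℤ) ≤ c.2 := by exact_mod_cast hM _ hm
      nlinarith
    · simp only []
      rw [hcast, show q₁ * nn + a₁ = (c.1.2 : ℤ) * c.2 by rw [hq]; ring]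
      exact ⟨c.2, rfl⟩
    · exact hΦΨ c.1.1 c.1.2 c.2 hd₁ hm hC1 ⟨hn1, hnx⟩ hΦ
  · -- injective
    intro c hc c' hc' heq
    rw [Finset.mem_coe, Finset.mem_filter] at hc hc'
    simp only [Prod.mk.injEq] at heq
    obtain ⟨hn, h1⟩ := heq
    obtain ⟨hmem, ⟨hC1, ⟨hn1, -⟩, -, -⟩, -⟩ := hc
    obtain ⟨hmem', ⟨hC1', ⟨hn1', -⟩, -, -⟩, -⟩ := hc'
    rw [Finset.mem_product, Finset.mem_product] at hmem hmem'
    have hd₁ : 1 ≤ c.1.2 := (Finset.mem_Icc.mp hmem.1.2).1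
    set nn : ℤ := ((c.1.2 : ℤ) * c.2 - a₁) / q₁ with hnn
    set nn' : ℤ := ((c'.1.2 : ℤ) * c'.2 - a₁) / q₁ with hnn'
    have hq : q₁ * nn = (c.1.2 : ℤ) * c.2 - a₁ := Int.mul_ediv_cancel' (Int.dvd_of_emod_eq_zero hC1)
    have hq' : q₁ * nn' = (c'.1.2 : ℤ) * c'.2 - a₁ := Int.mul_ediv_cancel' (Int.dvd_of_emod_eq_zero hC1')
    have he : nn = nn' := by
      have h0 : 0 ≤ nn := by omega
      have h0' : 0 ≤ nn' := by omega
      have := congrArg (fun k : ℕ => (k : ℤ)) hn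
      simp only [Int.toNat_of_nonneg h0, Int.toNat_of_nonneg h0'] at this
      exact this
    have hprod : (c.1.2 : ℤ) * c.2 = (c'.1.2 : ℤ) * c'.2 := by
      have := congrArg (fun k => q₁ * k) he
      simp only [hq, hq'] at this
      linarith
    rw [← h1] at hprod
    have hm : (c.2 : ℤ) = c'.2 := by
      have hd : (0 : ℤ) < c.1.2 := by exact_mod_cast hd₁
      exact mul_left_cancel₀ hd.ne' hprod
    have hm' : c.2 = c'.2 := by exact_mod_cast hm
    exact Prod.ext h1 hm'


/-- **Divisor-pair configurations over an `n`-set are counted by `τ·τ`.**  For any finset `S` of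
naturals: `#{(n,d₀,d₁) ∈ S × [1,Xb]² : d₀ ∣ q₀n+a₀ ≥ 1, d₁ ∣ q₁n+a₁ ≥ 1, Ψ} ≤ Σ_{n∈S} τ((q₀n+a₀)⁺) τ((q₁n+a₁)⁺)`. [folklore] -/
theorem card_core'_filter_le_sum_tau (q₀ a₀ q₁ a₁ : ℤ) (S : Finset ℕ) (Xb : ℕ)
    (Ψ : ℕ → ℕ × ℕ → Prop) [DecidablePred (fun e : ℕ × (ℕ × ℕ) => Ψ e.1 e.2)] :
    (((S ×ˢ ((Icc 1 Xb) ×ˢ (Icc 1 Xb))).filter (fun e : ℕ × (ℕ × ℕ) =>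
        ((1 ≤ q₀ * e.1 + a₀ ∧ (e.2.1 : ℤ) ∣ q₀ * e.1 + a₀) ∧
          (1 ≤ q₁ * e.1 + a₁ ∧ (e.2.2 : ℤ) ∣ q₁ * e.1 + a₁)) ∧ Ψ e.1 e.2)).card : ℝ) ≤
    ∑ n ∈ S, ((((q₀ * n + a₀).toNat).divisors.card : ℕ) : ℝ) *
      ((((q₁ * n + a₁).toNat).divisors.card : ℕ) : ℝ) := by
  classical
  set Tset : Finset ((_ : ℕ) × (ℕ × ℕ)) :=
    S.sigma (fun n => ((q₀ * n + a₀).toNat).divisors ×ˢ ((q₁ * n + a₁).toNat).divisors) with hT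
  have h1 : ((S ×ˢ ((Icc 1 Xb) ×ˢ (Icc 1 Xb))).filter (fun e : ℕ × (ℕ × ℕ) =>
        ((1 ≤ q₀ * e.1 + a₀ ∧ (e.2.1 : ℤ) ∣ q₀ * e.1 + a₀) ∧
          (1 ≤ q₁ * e.1 + a₁ ∧ (e.2.2 : ℤ) ∣ q₁ * e.1 + a₁)) ∧ Ψ e.1 e.2)) ⊆
      Tset.image (fun z => (z.1, z.2)) := by
    intro e he
    rw [Finset.mem_filter, Finset.mem_product] at he
    obtain ⟨⟨hn, -⟩, ⟨⟨h0, hd0⟩, ⟨h1, hd1⟩⟩, -⟩ := he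
    rw [Finset.mem_image]
    refine ⟨⟨e.1, e.2⟩, ?_, rfl⟩
    rw [hT, Finset.mem_sigma, Finset.mem_product]
    refine ⟨hn, ?_, ?_⟩
    · rw [Nat.mem_divisors]
      have hv : ((q₀ * e.1 + a₀).toNat : ℤ) = q₀ * e.1 + a₀ := Int.toNat_of_nonneg (by omega)
      refine ⟨?_, ?_⟩
      · have : ((e.2.1 : ℕ) : ℤ) ∣ ((q₀ * e.1 + a₀).toNat : ℤ) := by rw [hv]; exact hd0
        exact_mod_cast this
      · have : (0 : ℤ) < (q₀ * e.1 + a₀).toNat := by rw [hv]; omega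
        have : 0 < (q₀ * e.1 + a₀).toNat := by exact_mod_cast this
        exact this.ne'
    · rw [Nat.mem_divisors]
      have hv : ((q₁ * e.1 + a₁).toNat : ℤ) = q₁ * e.1 + a₁ := Int.toNat_of_nonneg (by omega)
      refine ⟨?_, ?_⟩
      · have : ((e.2.2 : ℕ) : ℤ) ∣ ((q₁ * e.1 + a₁).toNat : ℤ) := by rw [hv]; exact hd1
        exact_mod_cast this
      · have : (0 : ℤ) < (q₁ * e.1 + a₁).toNat := by rw [hv]; omega
        have : 0 < (q₁ * e.1 + a₁).toNat := by exact_mod_cast this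
        exact this.ne'
  calc ((((S ×ˢ ((Icc 1 Xb) ×ˢ (Icc 1 Xb))).filter (fun e : ℕ × (ℕ × ℕ) =>
        ((1 ≤ q₀ * e.1 + a₀ ∧ (e.2.1 : ℤ) ∣ q₀ * e.1 + a₀) ∧
          (1 ≤ q₁ * e.1 + a₁ ∧ (e.2.2 : ℤ) ∣ q₁ * e.1 + a₁)) ∧ Ψ e.1 e.2)).card : ℕ) : ℝ)
      ≤ ((Tset.image (fun z => (z.1, z.2))).card : ℝ) := by exact_mod_cast Finset.card_le_card h1
    _ ≤ (Tset.card : ℝ) := by exact_mod_cast Finset.card_image_le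
    _ = ∑ n ∈ S, ((((q₀ * n + a₀).toNat).divisors.card : ℕ) : ℝ) *
          ((((q₁ * n + a₁).toNat).divisors.card : ℕ) : ℝ) := by
        rw [hT, Finset.card_sigma]; push_cast
        refine Finset.sum_congr rfl fun n _ => ?_
        rw [Finset.card_product]; push_cast; ring

end LinearPairConfig

end Literature.NumberTheory.Sieve
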